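import Summits.QuantumFields.YangMills.Theorems.BalabanUVNodesN21KeyedShellWeightShellZero
import Summits.QuantumFields.YangMills.Theorems.BalabanUVNodesSpineReadingOfRecord13CoPHV

/-!
# BalabanUVNodes ∕ N20 · N21 · N27x faces — THE ZERO-DIAL BUNDLE AT THE SPINE READING OF RECORD WITH THE PHYSICAL VOLUME LETTER, ON THE LIVE LINE:
# at `(jcut, sh) = (0, zero split)` the reading `crOfRecord₁₃VAt K₀ (fun _ ↦ 0) (zero split)` (dag-n20-d's edition V, `vol := F.side ^ 4` — the K3⁷ v3 pointer)
# carries `RelWeightBound` and `ShellWeightBound` at EVERY Stage-13 tuple with core provisos, with CANONICAL weights `W = 0`, `Wsh = 0`; on the LIVE-SELECTOR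
# line under (H-U) ∕ (H-ζ) it carries the extraction identities E1 ∕ E2 with the sign law `0 ≤ ζ` READ OFF THE PROVISOS; what is left of K3⁷ v3 stub 2 at that dial
# is the EXACT NE7 core sandwich on EVERY keyed class with NO shell allowance, displayed here as the one input of `core_∕hybridNE7_crOfRecord₁₃VAt_zeroDial_of_core`

Cell `pub-ymgap` (HUMAN RULING D-0062 Track A; work-bound push D-0149, director-ym №197), width seat `pub-ymgap-dag-n20-w1` (N20 NE7b WIDTH SEAT 1 of 3), generation g2,
module 5 of the seat = plan g81 OPTIONAL № 14 (pub-ymgap INBOX l.26426: «after n20-w2's `…N21KeyedShellWeightShellZero` LANDS, ONE by-name bundle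
`faces_crOfRecord₁₃VAt_zeroDial_of_live` (RelWeight ∧ ShellWeight ∧ Extraction at `(K₀, jcut, sh) = (0, 0, vanishing)` on live tuples under n20-d's extraction binders;
the kernel form of (iii))»; dag-n20-w2 first refusal WAIVED l.26452; «№ 14 is n20-w1's» l.26568).  Filed `--kind proof --supports stmt-QuantumFields-20544 --as helper` (K3⁷
`SpineGivenEndpointR13SepCoPH`); COUNT-NEUTRAL.  [III] = [Balaban1988Convergent], [LF-I] = [Balaban1989LargeFieldI], [LF-II] = [Balaban1989LargeFieldII].

WHY.  The registered K3⁷ skeleton v3 (plan g81, `HOME/pub-ymgap-plan/D81-K3V3/K3Skeleton13SepCoPHv3.lean` 02f6f498332fdbee) pins stub 2's spine reading ON THE LIVE LINE to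
`crOfRecord₁₃V (jc F θ hP g₀ os) sh := crOfRecord₁₃VAt 0 (jc …) sh` (`PinnedAtLive`; (t-JC): the cut policy `jc` is READ PER TUPLE; (t-V): the physical-volume edition) and asks
for `KeyedRelWeight cr ∧ KeyedShellWeight cr ∧ KeyedExtraction cr ∧ KeyedCoreEdgeHolderD4 β cr rr`.  Its header (iii) says: «at `(jc, sh) = (0, vanishing split)` every face of
stub 2 but the EXACT NE7 core edge on every keyed class is free».  The two free faces are dag-n20-w2's LOCATED theorems at the v1.0 reading `crOfRecord₁₃At` (p590852
`relWeightBound_carriers₁₃_cutZero`, p593923 `shellWeightBound_carriers₁₃_shellZero`); the extraction face is dag-n20-d's `keyedExtraction_crOfRecord₁₃VAt` under the live-selector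
pin `hsel` and the laws (H-U) `LocalBgMeasurable`, (H-ζ) `ZetaMeasurable`, `0 ≤ ζ` — and `0 ≤ ζ` is dag-n20-w2's `zeta_nonneg_of_provisos₁₃CoPH` (rows `zetaUnity ∕ zetaAbs`).  This
file puts the three together AT THE v3 POINTER, BY NAME, and displays what remains:
* §1 THE TWO FREE FACES AT THE V READING (every tuple, every `K₀`): ★ `relWeightBound_crOfRecord₁₃VAt_cutZero` (any `sh`) · ★ `shellWeightBound_crOfRecord₁₃VAt_shellZero` (any
  `jcut`) · `lt_one_crOfRecord₁₃VAt_zeroDial` · the dictionary corollaries `crOfRecord₁₃VAt_W_cutZero` ∕ `crOfRecord₁₃VAt_Wsh_shellZero`: the reading's CANONICAL weights ARE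
  `0` there (`wInf_nonneg` ∕ `wInf_le_of_relWeightBound` at the zero witness) — so node U5's exit remainder `hybridDelta vol δ (W + Wsh)` at the zero dial reads the N19′ rate `δ`
  ALONE;
* §2 EXTRACTION AT THE V READING ON THE LIVE LINE WITH `0 ≤ ζ` DISCHARGED: ★ `keyedExtraction_crOfRecord₁₃VAt_of_liveSel` (dag-n20-d's theorem minus its `hζ0` letter; any
  `K₀`, `jcut`, `sh`) · `extraction_crOfRecord₁₃VAt_at_of_liveSel` (the four clauses `0 < l₀`, `0 < vol`, E1, E2 at ONE `(g₀, os)` — the form a per-tuple cut reading `jc` needs;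
  sibling with `hζ0` displayed and `ForSmallCouplings` at a per-tuple cut: dag-n27-c `keyedExtraction_crOfRecord₁₃VAt_cut`, p595448 — not imported here to keep this module light);
* §3 ★★ THE BUNDLE `faces_crOfRecord₁₃VAt_zeroDial_of_live`: at a Stage-13 tuple with core provisos ON THE LIVE-SELECTOR LINE under (H-U) ∕ (H-ζ), for every `g₀`, `os`:
  `RelWeightBound ∧ ShellWeightBound ∧ (∀ K, W K + Wsh K < 1) ∧ (0 < l₀ ∧ 0 < vol ∧ E1 ∧ E2)` at `crOfRecord₁₃VAt K₀ (fun _ ↦ 0) (zero split) F θ hP g₀ os`;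
* §4 THE K3⁷ v3 BINDER SHAPES (`N = 2`, every guarded admissible tuple — the guards unused): `keyedRelWeight_shape_crOfRecord₁₃V_cutZero` (the body of `KeyedRelWeight
  (crOfRecord₁₃V (fun _ ↦ 0) sh)`, V twin of p590852's) · `keyedShellWeight_shape_crOfRecord₁₃V_shellZero` (V twin of p593923's, every `jcut`) ·
  `keyedShellWeight_shape_crOfRecord₁₃VAt_cutReading_shellZero` (the same at a PER-TUPLE cut reading `jc`, (t-JC)) · `keyedExtraction_shape_crOfRecord₁₃VAt_cutReading_of_live`
  (the body of `KeyedExtraction (fun F θ hP g₀ os ↦ crOfRecord₁₃VAt 0 (jc F θ hP g₀ os) sh F θ hP g₀ os)` for ANY `jc`, `sh`, from the KEYED binders «LiveSel ∧ (H-U) ∧ (H-ζ) at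
  every guarded admissible tuple» — HONEST SCOPE: that keyed hypothesis is what a proviso edition `… ∧ LiveSel` ((w18)) would supply; today `PinnedAtLive` pins the reading on the
  live line only and NO extraction theorem exists off it (v2 ∕ v3 located reason), so the PER-TUPLE §2–§3 forms are the ones of record);
* §5 WHAT IS LEFT AT THE ZERO DIAL: `core_cutZero_iff_sandwich` (dictionary: with the zero cut's EMPTY bad class, `badClass₁₃_cutZero`, `NE7.Core` at the class set of record
  excuses NO class) · ★ `core_crOfRecord₁₃VAt_zeroDial_of_core` — from an NE7-PROPER WITNESS ON THE FULL KEYED CLASS WEIGHTS `NE7.Core 1 (F.side ^ 4) (classSet₁₃ …)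
  (badClass₁₃ … (fun _ ↦ 0)) (weightA₁₃ …) (weightB₁₃ …) δ` with `Summable δ` (dag-n27-c X §5's currency, INBOX l.26695) the core conjunct AT the zero-dial reading (dag-n20-d's
  `core_crOfRecord₁₃VAt`, its sign letter `hP0` := dag-n20-w2's `weightA₁₃_nonneg`, `sub_zero` under the binders) · `core_crOfRecord₁₃VAt_zeroDial_of_sandwich` — the same from
  the BARE DISPLAYED sandwich «for every `K` one constant `c` with `e^{c − F.side⁴·δ_K}·weightA₁₃ ≤ weightB₁₃ ≤ e^{c + F.side⁴·δ_K}·weightA₁₃` on EVERY class of `classSet₁₃ θ K₀ g₀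
  K`, `|t| ≤ 1`» (no bad class excused, no shell subtracted: N19′'s XL body at this dial, NAMED OPEN) · `hybridNE7_crOfRecord₁₃VAt_zeroDial_of_core` (hence node U5's whole
  `HybridNE7` datum at that reading, `NE7.hybridNE7_of_core` with §1).
Cited BY NAME, not re-typed: dag-n20-d `…SpineReadingOfRecord13CoPH(V)` (`classSet₁₃`, `weightA₁₃`, `weightB₁₃`, `badClass₁₃`, `ShellSplit₁₃CoPH`, `crOfRecord₁₃VAt`, `crOfRecord₁₃V`,
`relWeightBound_∕shellWeightBound_∕core_∕lt_one_crOfRecord₁₃VAt`, `keyedExtraction_crOfRecord₁₃VAt`, `schemeZ_(succ_)eq_sum_classSet_weight{A,B}`), `…SpineCanonicalWeights` (`wInf_nonneg`,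
`wInf_le_of_relWeightBound`, `wshInf_nonneg`, `wshInf_le_of_shellWeightBound`), dag-n20-w2 p590852 ∕ p593923 (above), `Spine/NE7/Targets` (`NE7.Core`, `NE7.hybridNE7_of_core`).

HONEST FRAMING.  Count-neutral kernel bookkeeping BY NAME (V twins + one bundle + one dictionary iff + two transfers); proves NO estimate; the located reading is unchanged (plan g80∕g81 ruling (a):
`jc` ∕ `sh` are the PROVER's dials, no guard, no re-cut; dag-lead: N20's ∕ N21's node discharge = the NE7b ∕ NE7c content AT THE POLICY THE CLOSING PROOF OF STUB 2 USES — at the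
zero dial that content sits entirely in §5's displayed sandwich).  Nothing of Bałaban's is asserted or instantiated: NE7 ∕ NE7b ∕ NE7c NOT PRINTED for `d = 4`, NOT proved; no
`Provisos₁₃CoPH` inhabitant claimed (K0⁷ OPEN); (H-U) ∕ (H-ζ) ∕ the live-selector pin are DISPLAYED hypotheses; (α)-instance 0∕1; N19 ∕ N20 ∕ N21 ∕ N27 NOT discharged; K3⁷ NOT
closed (stub 1 and stub 2's core conjunct untouched); counts unmoved (typed 28∕28 · discharged 5∕27); no count claim.  One finite `𝕋⁴_{L^K}` programme at fixed `ε = L^{−K}`, Bałaban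
AS PRINTED; the YM mass gap (Clay) is NOT proved by any of this — R4 closes the conditional finite-𝕋⁴ rung `BalabanLadder.UV` only; NOT ℝ⁴, NOT infinite volume, NOT OS.
No `def`, no `instance`, no `notation`, no `sorry`.  Sources (locators, bookkeeping only): [III] (2.18) p.257, (3.16) p.268, (3.21) p.269; [LF-I] (0.2)–(0.4) p.176;
[LF-II] Thm 1 + (0.1) pp.355–356, (1.80) p.384; [King1986] (3.10)–(3.11) p.656.  No decl below carries a cite tag.
-/

noncomputable section

open scoped BigOperators

namespace Summit.QuantumFields.YangMills.BalabanUVNodes.N20ZeroDialFacesAtRecord13CoPHV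

open Literature.MathematicalPhysics.QuantumFieldTheory.Balaban1983to89 Literature.MathematicalPhysics.QuantumFieldTheory.Balaban1983to89.Node00
open T4Continuum
open T4WeightBudget (RelWeightBound)
open T4IndicatorShell (ShellWeightBound)
open T4MatchingAssembly (HybridNE7)
open T4ContinuumYM4Torus (ForSmallCouplings)
open Summit.QuantumFields.BalabanUV.T4Continuum.Spine
open YMDAG.UVSplit hiding SU
open Summit.QuantumFields.YangMills.BalabanUVNodes.SpineCanonicalWeights (wInf_nonneg wInf_le_of_relWeightBound wshInf_nonneg wshInf_le_of_shellWeightBound)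
open Summit.QuantumFields.YangMills.BalabanUVNodes.N20KeyedRelWeightCutZero (badClass₁₃_cutZero relWeightBound_carriers₁₃_cutZero)
open Summit.QuantumFields.YangMills.BalabanUVNodes.N21KeyedShellWeightShellZero
  (zeta_nonneg_of_provisos₁₃CoPH weightA₁₃_nonneg shellWeightBound_carriers₁₃_shellZero)

variable {F : T4Family} {N : ℕ} [NeZero N]

/-! ## §1  The two free faces at the V reading, and its canonical weights there -/

section FreeFaces

variable (K₀ : ℕ) (θ : Stage13HParams F N) (hP : θ.Provisos₁₃CoPH F N) (g₀ : ℕ → ℝ) (os : List (ULoop F))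

/-- ★ **THE N20 FACE AT `crOfRecord₁₃VAt K₀ (fun _ ↦ 0) sh` HOLDS FOR EVERY TUPLE** (V twin of dag-n20-w2's `relWeightBound_crOfRecord₁₃At_cutZero`: the zero cut's bad class is
empty, the zero weight is a witness, the reading's canonical `W` inherits it by dag-n20-d's `relWeightBound_crOfRecord₁₃VAt`); any shell split `sh`. [bookkeeping] -/
theorem relWeightBound_crOfRecord₁₃VAt_cutZero (sh : ShellSplit₁₃CoPH N K₀) :
    RelWeightBound (crOfRecord₁₃VAt K₀ (fun _ => 0) sh F θ hP g₀ os).l₀ (crOfRecord₁₃VAt K₀ (fun _ => 0) sh F θ hP g₀ os).T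
      (crOfRecord₁₃VAt K₀ (fun _ => 0) sh F θ hP g₀ os).A (crOfRecord₁₃VAt K₀ (fun _ => 0) sh F θ hP g₀ os).B
      (crOfRecord₁₃VAt K₀ (fun _ => 0) sh F θ hP g₀ os).Bad (crOfRecord₁₃VAt K₀ (fun _ => 0) sh F θ hP g₀ os).W :=
  relWeightBound_crOfRecord₁₃VAt K₀ _ sh θ hP g₀ os (relWeightBound_carriers₁₃_cutZero F θ hP K₀ g₀ os)

/-- ★ **THE N21 FACE AT `crOfRecord₁₃VAt K₀ jcut (zero split)` HOLDS FOR EVERY TUPLE** (V twin of dag-n20-w2's `shellWeightBound_crOfRecord₁₃At_shellZero`: the keyed class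
weights of record are `≥ 0` by the provisos' ζ-rows, so zero shells with zero shell weight are a witness); any cut policy `jcut`. [bookkeeping] -/
theorem shellWeightBound_crOfRecord₁₃VAt_shellZero (jcut : ℕ → ℕ) :
    ShellWeightBound (crOfRecord₁₃VAt K₀ jcut (fun _ _ _ _ _ => (fun _ _ _ => 0, fun _ _ _ => 0)) F θ hP g₀ os).l₀
      (crOfRecord₁₃VAt K₀ jcut (fun _ _ _ _ _ => (fun _ _ _ => 0, fun _ _ _ => 0)) F θ hP g₀ os).T
      (crOfRecord₁₃VAt K₀ jcut (fun _ _ _ _ _ => (fun _ _ _ => 0, fun _ _ _ => 0)) F θ hP g₀ os).A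
      (crOfRecord₁₃VAt K₀ jcut (fun _ _ _ _ _ => (fun _ _ _ => 0, fun _ _ _ => 0)) F θ hP g₀ os).B
      (crOfRecord₁₃VAt K₀ jcut (fun _ _ _ _ _ => (fun _ _ _ => 0, fun _ _ _ => 0)) F θ hP g₀ os).shA
      (crOfRecord₁₃VAt K₀ jcut (fun _ _ _ _ _ => (fun _ _ _ => 0, fun _ _ _ => 0)) F θ hP g₀ os).shB
      (crOfRecord₁₃VAt K₀ jcut (fun _ _ _ _ _ => (fun _ _ _ => 0, fun _ _ _ => 0)) F θ hP g₀ os).Wsh :=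
  shellWeightBound_crOfRecord₁₃VAt K₀ jcut _ θ hP g₀ os (shellWeightBound_carriers₁₃_shellZero F θ hP K₀ g₀ os)

/-- **AT THE ZERO DIAL U4′'s `W K + Wsh K < 1` HOLDS WITH THE READING's CANONICAL WEIGHTS** (V twin of dag-n20-w2's `lt_one_crOfRecord₁₃At_zeroDial`). [bookkeeping] -/
theorem lt_one_crOfRecord₁₃VAt_zeroDial (K : ℕ) :
    (crOfRecord₁₃VAt K₀ (fun _ => 0) (fun _ _ _ _ _ => (fun _ _ _ => 0, fun _ _ _ => 0)) F θ hP g₀ os).W K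
      + (crOfRecord₁₃VAt K₀ (fun _ => 0) (fun _ _ _ _ _ => (fun _ _ _ => 0, fun _ _ _ => 0)) F θ hP g₀ os).Wsh K < 1 :=
  lt_one_crOfRecord₁₃VAt K₀ _ _ θ hP g₀ os (relWeightBound_carriers₁₃_cutZero F θ hP K₀ g₀ os)
    (shellWeightBound_carriers₁₃_shellZero F θ hP K₀ g₀ os) (fun _ => by norm_num) K

/-- **DICTIONARY: AT THE ZERO CUT THE READING's CANONICAL RELATIVE WEIGHT IS `0`** (the least admissible weight of an empty bad class: `0 ≤ wInf ≤ 0`); any `sh`.  So at that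
dial node U5's exit remainder `hybridDelta vol δ (W + Wsh)` has no N20 share. [bookkeeping] -/
theorem crOfRecord₁₃VAt_W_cutZero (sh : ShellSplit₁₃CoPH N K₀) (K : ℕ) : (crOfRecord₁₃VAt K₀ (fun _ => 0) sh F θ hP g₀ os).W K = 0 :=
  le_antisymm (wInf_le_of_relWeightBound (relWeightBound_carriers₁₃_cutZero F θ hP K₀ g₀ os) K) (wInf_nonneg K)

/-- **DICTIONARY: AT THE ZERO SHELL SPLIT THE READING's CANONICAL RELATIVE SHELL WEIGHT IS `0`**; any `jcut`. [bookkeeping] -/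
theorem crOfRecord₁₃VAt_Wsh_shellZero (jcut : ℕ → ℕ) (K : ℕ) :
    (crOfRecord₁₃VAt K₀ jcut (fun _ _ _ _ _ => (fun _ _ _ => 0, fun _ _ _ => 0)) F θ hP g₀ os).Wsh K = 0 :=
  le_antisymm (wshInf_le_of_shellWeightBound (shellWeightBound_carriers₁₃_shellZero F θ hP K₀ g₀ os) K) (wshInf_nonneg K)

end FreeFaces

/-! ## §2  Extraction at the V reading on the live-selector line, the sign law `0 ≤ ζ` read off the provisos -/

section Extraction

variable (K₀ : ℕ) (jcut : ℕ → ℕ) (sh : ShellSplit₁₃CoPH N K₀) (θ : Stage13HParams F N) (hP : θ.Provisos₁₃CoPH F N) (E : B12.RunParams → ℝ)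

/-- ★ **THE EXTRACTION FACE AT `crOfRecord₁₃VAt K₀ jcut sh` ON THE LIVE-SELECTOR LINE, `0 ≤ ζ` DISCHARGED** — dag-n20-d's `keyedExtraction_crOfRecord₁₃VAt` with its third law
supplied by dag-n20-w2's `zeta_nonneg_of_provisos₁₃CoPH` (rows `zetaUnity`, `zetaAbs` of `hP`): under the pin `hsel` and the DISPLAYED laws (H-U) `LocalBgMeasurable` ∕ (H-ζ)
`ZetaMeasurable`, `0 < l₀`, `0 < vol`, E1 ∕ E2 for EVERY `g₀` (so `ForSmallCouplings` by `of_forall`); any `K₀`, `jcut`, `sh`. [bookkeeping] -/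
theorem keyedExtraction_crOfRecord₁₃VAt_of_liveSel (hsel : θ.ppSel = ppSelLiveOfRecord F N θ.ν θ.τ9 E (wOfRecord₉ F N θ.toStage9Params))
    (hU : LocalBgMeasurable F N θ.ν) (hζm : ZetaMeasurable F N θ.ζ) :
    ForSmallCouplings (datumOfRecord₁₃CoPH F N θ hP) fun g₀ => ∀ os : List (ULoop F),
      0 < (crOfRecord₁₃VAt K₀ jcut sh F θ hP g₀ os).l₀ ∧ 0 < (crOfRecord₁₃VAt K₀ jcut sh F θ hP g₀ os).vol ∧
      (∀ (K : ℕ) (t : ℝ), |t| ≤ (crOfRecord₁₃VAt K₀ jcut sh F θ hP g₀ os).l₀ →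
        T4GenFunBounds.schemeZ ((datumOfRecord₁₃CoPH F N θ hP).scheme g₀) os ((crOfRecord₁₃VAt K₀ jcut sh F θ hP g₀ os).K₀ + K) t =
          ∑ τ ∈ (crOfRecord₁₃VAt K₀ jcut sh F θ hP g₀ os).T K, (crOfRecord₁₃VAt K₀ jcut sh F θ hP g₀ os).A K t τ) ∧
      (∀ (K : ℕ) (t : ℝ), |t| ≤ (crOfRecord₁₃VAt K₀ jcut sh F θ hP g₀ os).l₀ →
        T4GenFunBounds.schemeZ ((datumOfRecord₁₃CoPH F N θ hP).scheme g₀) os ((crOfRecord₁₃VAt K₀ jcut sh F θ hP g₀ os).K₀ + K + 1) t =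
          ∑ τ ∈ (crOfRecord₁₃VAt K₀ jcut sh F θ hP g₀ os).T K, (crOfRecord₁₃VAt K₀ jcut sh F θ hP g₀ os).B K t τ) :=
  keyedExtraction_crOfRecord₁₃VAt K₀ jcut sh θ hP E hsel hU hζm (zeta_nonneg_of_provisos₁₃CoPH F θ hP)

/-- **THE FOUR EXTRACTION CLAUSES AT ONE `(g₀, os)`** on the live-selector line under (H-U) ∕ (H-ζ): `0 < l₀ = 1`, `0 < vol = F.side ^ 4`, E1, E2 (dag-n20-d's
`schemeZ_eq_sum_classSet_weightA` ∕ `schemeZ_succ_eq_sum_classSet_weightB`, `0 ≤ ζ` from `hP`) — the pointwise form a PER-TUPLE cut reading `jc F θ hP g₀ os` instantiates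
((t-JC)); any `K₀`, `jcut`, `sh`. [bookkeeping] -/
theorem extraction_crOfRecord₁₃VAt_at_of_liveSel (hsel : θ.ppSel = ppSelLiveOfRecord F N θ.ν θ.τ9 E (wOfRecord₉ F N θ.toStage9Params))
    (hU : LocalBgMeasurable F N θ.ν) (hζm : ZetaMeasurable F N θ.ζ) (g₀ : ℕ → ℝ) (os : List (ULoop F)) :
    0 < (crOfRecord₁₃VAt K₀ jcut sh F θ hP g₀ os).l₀ ∧ 0 < (crOfRecord₁₃VAt K₀ jcut sh F θ hP g₀ os).vol ∧
      (∀ (K : ℕ) (t : ℝ), |t| ≤ (crOfRecord₁₃VAt K₀ jcut sh F θ hP g₀ os).l₀ →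
        T4GenFunBounds.schemeZ ((datumOfRecord₁₃CoPH F N θ hP).scheme g₀) os ((crOfRecord₁₃VAt K₀ jcut sh F θ hP g₀ os).K₀ + K) t =
          ∑ τ ∈ (crOfRecord₁₃VAt K₀ jcut sh F θ hP g₀ os).T K, (crOfRecord₁₃VAt K₀ jcut sh F θ hP g₀ os).A K t τ) ∧
      (∀ (K : ℕ) (t : ℝ), |t| ≤ (crOfRecord₁₃VAt K₀ jcut sh F θ hP g₀ os).l₀ →
        T4GenFunBounds.schemeZ ((datumOfRecord₁₃CoPH F N θ hP).scheme g₀) os ((crOfRecord₁₃VAt K₀ jcut sh F θ hP g₀ os).K₀ + K + 1) t =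
          ∑ τ ∈ (crOfRecord₁₃VAt K₀ jcut sh F θ hP g₀ os).T K, (crOfRecord₁₃VAt K₀ jcut sh F θ hP g₀ os).B K t τ) :=
  ⟨one_pos, pow_pos F.side_pos 4,
    fun K t _ => schemeZ_eq_sum_classSet_weightA K₀ θ hP E hsel hU hζm (zeta_nonneg_of_provisos₁₃CoPH F θ hP) g₀ os K t,
    fun K t _ => schemeZ_succ_eq_sum_classSet_weightB K₀ θ hP E hsel hU hζm (zeta_nonneg_of_provisos₁₃CoPH F θ hP) g₀ os K t⟩

end Extraction

/-! ## §3  ★★ The bundle: the three free faces at the zero-dial V reading of a live tuple -/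

section Bundle

variable (K₀ : ℕ) (θ : Stage13HParams F N) (hP : θ.Provisos₁₃CoPH F N) (E : B12.RunParams → ℝ)

/-- ★★ **THE ZERO-DIAL BUNDLE ON THE LIVE LINE** (plan g81 OPTIONAL № 14): at a Stage-13 tuple with core provisos whose residual selector IS the live selector of record (`hsel`),
under the displayed laws (H-U) ∕ (H-ζ), for every `g₀`, `os`, the reading `crOfRecord₁₃VAt K₀ (fun _ ↦ 0) (zero split) F θ hP g₀ os` carries: the N20 face `RelWeightBound`
(§1, no hypothesis), the N21 face `ShellWeightBound` (§1, no hypothesis), U4′'s `W + Wsh < 1` (§1), and the N27x extraction clauses `0 < l₀ ∧ 0 < vol ∧ E1 ∧ E2` (§2).  At this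
dial K3⁷ v3 stub 2 therefore owes exactly its core conjunct (§5 displays it). [bookkeeping] -/
theorem faces_crOfRecord₁₃VAt_zeroDial_of_live (hsel : θ.ppSel = ppSelLiveOfRecord F N θ.ν θ.τ9 E (wOfRecord₉ F N θ.toStage9Params))
    (hU : LocalBgMeasurable F N θ.ν) (hζm : ZetaMeasurable F N θ.ζ) (g₀ : ℕ → ℝ) (os : List (ULoop F)) :
    RelWeightBound (crOfRecord₁₃VAt K₀ (fun _ => 0) (fun _ _ _ _ _ => (fun _ _ _ => 0, fun _ _ _ => 0)) F θ hP g₀ os).l₀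
        (crOfRecord₁₃VAt K₀ (fun _ => 0) (fun _ _ _ _ _ => (fun _ _ _ => 0, fun _ _ _ => 0)) F θ hP g₀ os).T
        (crOfRecord₁₃VAt K₀ (fun _ => 0) (fun _ _ _ _ _ => (fun _ _ _ => 0, fun _ _ _ => 0)) F θ hP g₀ os).A
        (crOfRecord₁₃VAt K₀ (fun _ => 0) (fun _ _ _ _ _ => (fun _ _ _ => 0, fun _ _ _ => 0)) F θ hP g₀ os).B
        (crOfRecord₁₃VAt K₀ (fun _ => 0) (fun _ _ _ _ _ => (fun _ _ _ => 0, fun _ _ _ => 0)) F θ hP g₀ os).Bad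
        (crOfRecord₁₃VAt K₀ (fun _ => 0) (fun _ _ _ _ _ => (fun _ _ _ => 0, fun _ _ _ => 0)) F θ hP g₀ os).W ∧
      ShellWeightBound (crOfRecord₁₃VAt K₀ (fun _ => 0) (fun _ _ _ _ _ => (fun _ _ _ => 0, fun _ _ _ => 0)) F θ hP g₀ os).l₀
        (crOfRecord₁₃VAt K₀ (fun _ => 0) (fun _ _ _ _ _ => (fun _ _ _ => 0, fun _ _ _ => 0)) F θ hP g₀ os).T
        (crOfRecord₁₃VAt K₀ (fun _ => 0) (fun _ _ _ _ _ => (fun _ _ _ => 0, fun _ _ _ => 0)) F θ hP g₀ os).A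
        (crOfRecord₁₃VAt K₀ (fun _ => 0) (fun _ _ _ _ _ => (fun _ _ _ => 0, fun _ _ _ => 0)) F θ hP g₀ os).B
        (crOfRecord₁₃VAt K₀ (fun _ => 0) (fun _ _ _ _ _ => (fun _ _ _ => 0, fun _ _ _ => 0)) F θ hP g₀ os).shA
        (crOfRecord₁₃VAt K₀ (fun _ => 0) (fun _ _ _ _ _ => (fun _ _ _ => 0, fun _ _ _ => 0)) F θ hP g₀ os).shB
        (crOfRecord₁₃VAt K₀ (fun _ => 0) (fun _ _ _ _ _ => (fun _ _ _ => 0, fun _ _ _ => 0)) F θ hP g₀ os).Wsh ∧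
      (∀ K : ℕ, (crOfRecord₁₃VAt K₀ (fun _ => 0) (fun _ _ _ _ _ => (fun _ _ _ => 0, fun _ _ _ => 0)) F θ hP g₀ os).W K
        + (crOfRecord₁₃VAt K₀ (fun _ => 0) (fun _ _ _ _ _ => (fun _ _ _ => 0, fun _ _ _ => 0)) F θ hP g₀ os).Wsh K < 1) ∧
      (0 < (crOfRecord₁₃VAt K₀ (fun _ => 0) (fun _ _ _ _ _ => (fun _ _ _ => 0, fun _ _ _ => 0)) F θ hP g₀ os).l₀ ∧
        0 < (crOfRecord₁₃VAt K₀ (fun _ => 0) (fun _ _ _ _ _ => (fun _ _ _ => 0, fun _ _ _ => 0)) F θ hP g₀ os).vol ∧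
        (∀ (K : ℕ) (t : ℝ), |t| ≤ (crOfRecord₁₃VAt K₀ (fun _ => 0) (fun _ _ _ _ _ => (fun _ _ _ => 0, fun _ _ _ => 0)) F θ hP g₀ os).l₀ →
          T4GenFunBounds.schemeZ ((datumOfRecord₁₃CoPH F N θ hP).scheme g₀) os
              ((crOfRecord₁₃VAt K₀ (fun _ => 0) (fun _ _ _ _ _ => (fun _ _ _ => 0, fun _ _ _ => 0)) F θ hP g₀ os).K₀ + K) t =
            ∑ τ ∈ (crOfRecord₁₃VAt K₀ (fun _ => 0) (fun _ _ _ _ _ => (fun _ _ _ => 0, fun _ _ _ => 0)) F θ hP g₀ os).T K,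
              (crOfRecord₁₃VAt K₀ (fun _ => 0) (fun _ _ _ _ _ => (fun _ _ _ => 0, fun _ _ _ => 0)) F θ hP g₀ os).A K t τ) ∧
        (∀ (K : ℕ) (t : ℝ), |t| ≤ (crOfRecord₁₃VAt K₀ (fun _ => 0) (fun _ _ _ _ _ => (fun _ _ _ => 0, fun _ _ _ => 0)) F θ hP g₀ os).l₀ →
          T4GenFunBounds.schemeZ ((datumOfRecord₁₃CoPH F N θ hP).scheme g₀) os
              ((crOfRecord₁₃VAt K₀ (fun _ => 0) (fun _ _ _ _ _ => (fun _ _ _ => 0, fun _ _ _ => 0)) F θ hP g₀ os).K₀ + K + 1) t =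
            ∑ τ ∈ (crOfRecord₁₃VAt K₀ (fun _ => 0) (fun _ _ _ _ _ => (fun _ _ _ => 0, fun _ _ _ => 0)) F θ hP g₀ os).T K,
              (crOfRecord₁₃VAt K₀ (fun _ => 0) (fun _ _ _ _ _ => (fun _ _ _ => 0, fun _ _ _ => 0)) F θ hP g₀ os).B K t τ)) :=
  ⟨relWeightBound_crOfRecord₁₃VAt_cutZero K₀ θ hP g₀ os _, shellWeightBound_crOfRecord₁₃VAt_shellZero K₀ θ hP g₀ os _,
    lt_one_crOfRecord₁₃VAt_zeroDial K₀ θ hP g₀ os, extraction_crOfRecord₁₃VAt_at_of_liveSel K₀ _ _ θ hP E hsel hU hζm g₀ os⟩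

end Bundle

/-! ## §4  The K3⁷ v3 binder shapes at the v3 pointer (`N = 2`, every guarded admissible Stage-13 tuple) -/

section Shapes

/-- **THE `KeyedRelWeight` BODY OF K3⁷ v3 AT `crOfRecord₁₃V (fun _ ↦ 0) sh`, SPELLED OUT** (every guarded admissible tuple, every `g₀`, `os`; the guards unused) — the V twin of
dag-n20-w2's `keyedRelWeight_shape_crOfRecord₁₃_cutZero`; a skeleton composer obtains `KeyedRelWeight (crOfRecord₁₃V (fun _ ↦ 0) sh)` from it by `fun F θ hP hU hθ g₀ os ↦ …`
(the `def` is the skeleton's, not the tree's).  At the constant cut reading `jc := fun _ _ _ _ _ ↦ (fun _ ↦ 0)` the (t-JC) pin `crOfRecord₁₃V (jc F θ hP g₀ os) sh` IS this reading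
(`rfl`). [bookkeeping] -/
theorem keyedRelWeight_shape_crOfRecord₁₃V_cutZero (sh : ShellSplit₁₃CoPH 2 0) :
    ∀ (F : T4Family) (θ : Stage13HParams F 2) (hP : θ.Provisos₁₃CoPH F 2), (θ.ZhUnity F 2 ∧ θ.SlotsNondegenerate₁₃ F 2) → θ.Admissible F 2 →
      ∀ (g₀ : ℕ → ℝ) (os : List (ULoop F)),
        RelWeightBound (crOfRecord₁₃V (fun _ => 0) sh F θ hP g₀ os).l₀ (crOfRecord₁₃V (fun _ => 0) sh F θ hP g₀ os).T
          (crOfRecord₁₃V (fun _ => 0) sh F θ hP g₀ os).A (crOfRecord₁₃V (fun _ => 0) sh F θ hP g₀ os).B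
          (crOfRecord₁₃V (fun _ => 0) sh F θ hP g₀ os).Bad (crOfRecord₁₃V (fun _ => 0) sh F θ hP g₀ os).W :=
  fun _ θ hP _ _ g₀ os => relWeightBound_crOfRecord₁₃VAt_cutZero 0 θ hP g₀ os sh

/-- **THE `KeyedShellWeight` BODY OF K3⁷ v3 AT `crOfRecord₁₃V jcut (zero split)`, SPELLED OUT** (every guarded admissible tuple; the guards unused) — the V twin of dag-n20-w2's
`keyedShellWeight_shape_crOfRecord₁₃_shellZero`, for EVERY tuple-blind cut policy `jcut`. [bookkeeping] -/
theorem keyedShellWeight_shape_crOfRecord₁₃V_shellZero (jcut : ℕ → ℕ) :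
    ∀ (F : T4Family) (θ : Stage13HParams F 2) (hP : θ.Provisos₁₃CoPH F 2), (θ.ZhUnity F 2 ∧ θ.SlotsNondegenerate₁₃ F 2) → θ.Admissible F 2 →
      ∀ (g₀ : ℕ → ℝ) (os : List (ULoop F)),
        ShellWeightBound (crOfRecord₁₃V jcut (fun _ _ _ _ _ => (fun _ _ _ => 0, fun _ _ _ => 0)) F θ hP g₀ os).l₀
          (crOfRecord₁₃V jcut (fun _ _ _ _ _ => (fun _ _ _ => 0, fun _ _ _ => 0)) F θ hP g₀ os).T
          (crOfRecord₁₃V jcut (fun _ _ _ _ _ => (fun _ _ _ => 0, fun _ _ _ => 0)) F θ hP g₀ os).A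
          (crOfRecord₁₃V jcut (fun _ _ _ _ _ => (fun _ _ _ => 0, fun _ _ _ => 0)) F θ hP g₀ os).B
          (crOfRecord₁₃V jcut (fun _ _ _ _ _ => (fun _ _ _ => 0, fun _ _ _ => 0)) F θ hP g₀ os).shA
          (crOfRecord₁₃V jcut (fun _ _ _ _ _ => (fun _ _ _ => 0, fun _ _ _ => 0)) F θ hP g₀ os).shB
          (crOfRecord₁₃V jcut (fun _ _ _ _ _ => (fun _ _ _ => 0, fun _ _ _ => 0)) F θ hP g₀ os).Wsh :=
  fun _ θ hP _ _ g₀ os => shellWeightBound_crOfRecord₁₃VAt_shellZero 0 θ hP g₀ os jcut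

/-- **THE `KeyedShellWeight` BODY AT A PER-TUPLE CUT READING `jc` WITH THE ZERO SHELL SPLIT** ((t-JC): the v3 pin `cr F θ hP g₀ os = crOfRecord₁₃VAt 0 (jc F θ hP g₀ os) (zero
split) F θ hP g₀ os`): free for EVERY `jc`. [bookkeeping] -/
theorem keyedShellWeight_shape_crOfRecord₁₃VAt_cutReading_shellZero
    (jc : (F : T4Family) → (θ : Stage13HParams F 2) → θ.Provisos₁₃CoPH F 2 → (ℕ → ℝ) → List (ULoop F) → ℕ → ℕ) :
    ∀ (F : T4Family) (θ : Stage13HParams F 2) (hP : θ.Provisos₁₃CoPH F 2), (θ.ZhUnity F 2 ∧ θ.SlotsNondegenerate₁₃ F 2) → θ.Admissible F 2 →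
      ∀ (g₀ : ℕ → ℝ) (os : List (ULoop F)),
        ShellWeightBound (crOfRecord₁₃VAt 0 (jc F θ hP g₀ os) (fun _ _ _ _ _ => (fun _ _ _ => 0, fun _ _ _ => 0)) F θ hP g₀ os).l₀
          (crOfRecord₁₃VAt 0 (jc F θ hP g₀ os) (fun _ _ _ _ _ => (fun _ _ _ => 0, fun _ _ _ => 0)) F θ hP g₀ os).T
          (crOfRecord₁₃VAt 0 (jc F θ hP g₀ os) (fun _ _ _ _ _ => (fun _ _ _ => 0, fun _ _ _ => 0)) F θ hP g₀ os).A
          (crOfRecord₁₃VAt 0 (jc F θ hP g₀ os) (fun _ _ _ _ _ => (fun _ _ _ => 0, fun _ _ _ => 0)) F θ hP g₀ os).B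
          (crOfRecord₁₃VAt 0 (jc F θ hP g₀ os) (fun _ _ _ _ _ => (fun _ _ _ => 0, fun _ _ _ => 0)) F θ hP g₀ os).shA
          (crOfRecord₁₃VAt 0 (jc F θ hP g₀ os) (fun _ _ _ _ _ => (fun _ _ _ => 0, fun _ _ _ => 0)) F θ hP g₀ os).shB
          (crOfRecord₁₃VAt 0 (jc F θ hP g₀ os) (fun _ _ _ _ _ => (fun _ _ _ => 0, fun _ _ _ => 0)) F θ hP g₀ os).Wsh :=
  fun F θ hP _ _ g₀ os => shellWeightBound_crOfRecord₁₃VAt_shellZero 0 θ hP g₀ os (jc F θ hP g₀ os)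

/-- **THE `KeyedExtraction` BODY OF K3⁷ v3 AT THE PER-TUPLE-CUT V READING `fun F θ hP g₀ os ↦ crOfRecord₁₃VAt 0 (jc F θ hP g₀ os) sh F θ hP g₀ os`, FROM KEYED LIVE BINDERS**:
IF at every guarded admissible Stage-13 tuple with core provisos the residual selector is the live selector of record (the skeleton's `LiveSel F θ`) and (H-U) ∕ (H-ζ) hold, THEN the
extraction body holds for EVERY cut reading `jc` and shell split `sh` (END and (B) are not read; `ForSmallCouplings` by `of_forall`).  HONEST SCOPE: the keyed hypothesis `hlive` is
what a proviso edition `… ∧ LiveSel` ((w18)) would supply; today the skeleton pins the reading on the live line only (`PinnedAtLive`) and leaves `cr` free off it, where NO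
extraction theorem exists — so THIS keyed form books nothing beyond §2's per-tuple theorem; it is the shape a (w18)-edition composer would cite. [bookkeeping] -/
theorem keyedExtraction_shape_crOfRecord₁₃VAt_cutReading_of_live
    (jc : (F : T4Family) → (θ : Stage13HParams F 2) → θ.Provisos₁₃CoPH F 2 → (ℕ → ℝ) → List (ULoop F) → ℕ → ℕ) (sh : ShellSplit₁₃CoPH 2 0)
    (hlive : ∀ (F : T4Family) (θ : Stage13HParams F 2), θ.Provisos₁₃CoPH F 2 → (θ.ZhUnity F 2 ∧ θ.SlotsNondegenerate₁₃ F 2) → θ.Admissible F 2 →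
      θ.ppSel = ppSelLiveOfRecord F 2 θ.ν θ.τ9 (EOfRecord₁₃ F 2 θ.toStage13Params) (wOfRecord₉ F 2 θ.toStage9Params) ∧
        LocalBgMeasurable F 2 θ.ν ∧ ZetaMeasurable F 2 θ.ζ) :
    ∀ (F : T4Family) (θ : Stage13HParams F 2) (hP : θ.Provisos₁₃CoPH F 2), (θ.ZhUnity F 2 ∧ θ.SlotsNondegenerate₁₃ F 2) → θ.Admissible F 2 →
      B16.EndStatementBPrinted (datumOfRecord₁₃CoPH F 2 θ hP).C → DagBinding.EndpointExistence (datumOfRecord₁₃CoPH F 2 θ hP).C.toB12 →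
        ForSmallCouplings (datumOfRecord₁₃CoPH F 2 θ hP) fun g₀ => ∀ os : List (ULoop F),
          0 < (crOfRecord₁₃VAt 0 (jc F θ hP g₀ os) sh F θ hP g₀ os).l₀ ∧ 0 < (crOfRecord₁₃VAt 0 (jc F θ hP g₀ os) sh F θ hP g₀ os).vol ∧
          (∀ (K : ℕ) (t : ℝ), |t| ≤ (crOfRecord₁₃VAt 0 (jc F θ hP g₀ os) sh F θ hP g₀ os).l₀ →
            T4GenFunBounds.schemeZ ((datumOfRecord₁₃CoPH F 2 θ hP).scheme g₀) os ((crOfRecord₁₃VAt 0 (jc F θ hP g₀ os) sh F θ hP g₀ os).K₀ + K) t =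
              ∑ τ ∈ (crOfRecord₁₃VAt 0 (jc F θ hP g₀ os) sh F θ hP g₀ os).T K, (crOfRecord₁₃VAt 0 (jc F θ hP g₀ os) sh F θ hP g₀ os).A K t τ) ∧
          (∀ (K : ℕ) (t : ℝ), |t| ≤ (crOfRecord₁₃VAt 0 (jc F θ hP g₀ os) sh F θ hP g₀ os).l₀ →
            T4GenFunBounds.schemeZ ((datumOfRecord₁₃CoPH F 2 θ hP).scheme g₀) os ((crOfRecord₁₃VAt 0 (jc F θ hP g₀ os) sh F θ hP g₀ os).K₀ + K + 1) t =
              ∑ τ ∈ (crOfRecord₁₃VAt 0 (jc F θ hP g₀ os) sh F θ hP g₀ os).T K, (crOfRecord₁₃VAt 0 (jc F θ hP g₀ os) sh F θ hP g₀ os).B K t τ) := by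
  intro F θ hP hU hθ _ _
  obtain ⟨hsel, hbg, hζm⟩ := hlive F θ hP hU hθ
  exact ForSmallCouplings.of_forall fun g₀ os => extraction_crOfRecord₁₃VAt_at_of_liveSel 0 (jc F θ hP g₀ os) sh θ hP _ hsel hbg hζm g₀ os

end Shapes

/-! ## §5  What is left at the zero dial: the exact NE7 core sandwich on EVERY keyed class, no shells -/

section Core

variable (K₀ : ℕ) (θ : Stage13HParams F N) (hP : θ.Provisos₁₃CoPH F N) (g₀ : ℕ → ℝ) (os : List (ULoop F))

/-- **DICTIONARY: AT THE ZERO CUT `NE7.Core` EXCUSES NO CLASS** — with `badClass₁₃ … (fun _ ↦ 0) = ∅` (dag-n20-w2's `badClass₁₃_cutZero`) the core leaf on any cores `P`, `Q`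
at the class set of record reads: for every `K` ONE constant `c` with `e^{c − vol·δ_K}·P ≤ Q ≤ e^{c + vol·δ_K}·P` on EVERY class of `classSet₁₃ θ K₀ g₀ K`, `|t| ≤ l₀`.
[bookkeeping] -/
theorem core_cutZero_iff_sandwich (l₀ vol : ℝ) (P Q : ℕ → ℝ → (Σ K, SiteSeqKey F (K₀ + K)) → ℝ) (δ : ℕ → ℝ) :
    (letI : DecidableEq (Σ K, SiteSeqKey F (K₀ + K)) := Classical.decEq _
     NE7.Core l₀ vol (classSet₁₃ θ K₀ g₀) (badClass₁₃ θ K₀ g₀ (fun _ => 0)) P Q δ) ↔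
    ∀ K : ℕ, ∃ c : ℝ, ∀ t : ℝ, |t| ≤ l₀ → ∀ x ∈ classSet₁₃ θ K₀ g₀ K,
      Real.exp (c - vol * δ K) * P K t x ≤ Q K t x ∧ Q K t x ≤ Real.exp (c + vol * δ K) * P K t x := by
  letI : DecidableEq (Σ K, SiteSeqKey F (K₀ + K)) := Classical.decEq _
  simp only [NE7.Core, badClass₁₃_cutZero, Finset.sdiff_empty]

/-- ★ **THE CORE CONJUNCT AT THE ZERO-DIAL V READING FROM AN NE7-PROPER WITNESS ON THE FULL KEYED CLASS WEIGHTS** (dag-n20-d's `core_crOfRecord₁₃VAt` at `(jcut, sh) =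
(fun _ ↦ 0, zero split)`, its sign letter `hP0` DISCHARGED by dag-n20-w2's `weightA₁₃_nonneg`; `sub_zero` under the binders): IF `NE7.Core 1 (F.side ^ 4)` holds for the keyed
class weights of record THEMSELVES (no shell subtracted) with the zero cut's EMPTY bad class and a summable rate `δ` — THE DISPLAYED HYPOTHESIS `h` IS N19′'s NE7 CONTENT AT THIS
DIAL (dag-n27-c X §5's witness currency), NOT PRINTED for `d = 4`, NOT proved, inhabited for no Bałaban family today — THEN `NE7.Core` holds AT the reading with its own canonical
rate, which is summable.  This is what K3⁷ v3 stub 2 still owes at the zero dial once §3 is booked. [bookkeeping] -/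
theorem core_crOfRecord₁₃VAt_zeroDial_of_core {δ : ℕ → ℝ}
    (h : letI : DecidableEq (Σ K, SiteSeqKey F (K₀ + K)) := Classical.decEq _
      NE7.Core 1 (F.side ^ 4) (classSet₁₃ θ K₀ g₀) (badClass₁₃ θ K₀ g₀ (fun _ => 0)) (weightA₁₃ θ hP K₀ g₀ os) (weightB₁₃ θ hP K₀ g₀ os) δ)
    (hδ : Summable δ) :
    (letI := (crOfRecord₁₃VAt K₀ (fun _ => 0) (fun _ _ _ _ _ => (fun _ _ _ => 0, fun _ _ _ => 0)) F θ hP g₀ os).dec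
     NE7.Core (crOfRecord₁₃VAt K₀ (fun _ => 0) (fun _ _ _ _ _ => (fun _ _ _ => 0, fun _ _ _ => 0)) F θ hP g₀ os).l₀
      (crOfRecord₁₃VAt K₀ (fun _ => 0) (fun _ _ _ _ _ => (fun _ _ _ => 0, fun _ _ _ => 0)) F θ hP g₀ os).vol
      (crOfRecord₁₃VAt K₀ (fun _ => 0) (fun _ _ _ _ _ => (fun _ _ _ => 0, fun _ _ _ => 0)) F θ hP g₀ os).T
      (crOfRecord₁₃VAt K₀ (fun _ => 0) (fun _ _ _ _ _ => (fun _ _ _ => 0, fun _ _ _ => 0)) F θ hP g₀ os).Bad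
      (fun K t τ => (crOfRecord₁₃VAt K₀ (fun _ => 0) (fun _ _ _ _ _ => (fun _ _ _ => 0, fun _ _ _ => 0)) F θ hP g₀ os).A K t τ
        - (crOfRecord₁₃VAt K₀ (fun _ => 0) (fun _ _ _ _ _ => (fun _ _ _ => 0, fun _ _ _ => 0)) F θ hP g₀ os).shA K t τ)
      (fun K t τ => (crOfRecord₁₃VAt K₀ (fun _ => 0) (fun _ _ _ _ _ => (fun _ _ _ => 0, fun _ _ _ => 0)) F θ hP g₀ os).B K t τ
        - (crOfRecord₁₃VAt K₀ (fun _ => 0) (fun _ _ _ _ _ => (fun _ _ _ => 0, fun _ _ _ => 0)) F θ hP g₀ os).shB K t τ)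
      (crOfRecord₁₃VAt K₀ (fun _ => 0) (fun _ _ _ _ _ => (fun _ _ _ => 0, fun _ _ _ => 0)) F θ hP g₀ os).δ) ∧
    Summable (crOfRecord₁₃VAt K₀ (fun _ => 0) (fun _ _ _ _ _ => (fun _ _ _ => 0, fun _ _ _ => 0)) F θ hP g₀ os).δ := by
  letI : DecidableEq (Σ K, SiteSeqKey F (K₀ + K)) := Classical.decEq _
  refine core_crOfRecord₁₃VAt K₀ (fun _ => 0) _ θ hP g₀ os (fun K t _ x _ => ?_) (by simpa using h) hδ
  simpa using weightA₁₃_nonneg F θ hP K₀ g₀ os K t x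

/-- ★ **THE SAME FROM THE BARE SANDWICH** — «for every `K` one constant `c` with `e^{c − F.side⁴·δ_K}·weightA₁₃ ≤ weightB₁₃ ≤ e^{c + F.side⁴·δ_K}·weightA₁₃` on EVERY class of
`classSet₁₃ θ K₀ g₀ K`, every source `|t| ≤ 1`» (no bad class excused, no shell subtracted) and `Σ δ < ∞` (`core_cutZero_iff_sandwich`). [bookkeeping] -/
theorem core_crOfRecord₁₃VAt_zeroDial_of_sandwich {δ : ℕ → ℝ}
    (h : ∀ K : ℕ, ∃ c : ℝ, ∀ t : ℝ, |t| ≤ 1 → ∀ x ∈ classSet₁₃ θ K₀ g₀ K,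
      Real.exp (c - F.side ^ 4 * δ K) * weightA₁₃ θ hP K₀ g₀ os K t x ≤ weightB₁₃ θ hP K₀ g₀ os K t x ∧
        weightB₁₃ θ hP K₀ g₀ os K t x ≤ Real.exp (c + F.side ^ 4 * δ K) * weightA₁₃ θ hP K₀ g₀ os K t x)
    (hδ : Summable δ) :
    (letI := (crOfRecord₁₃VAt K₀ (fun _ => 0) (fun _ _ _ _ _ => (fun _ _ _ => 0, fun _ _ _ => 0)) F θ hP g₀ os).dec
     NE7.Core (crOfRecord₁₃VAt K₀ (fun _ => 0) (fun _ _ _ _ _ => (fun _ _ _ => 0, fun _ _ _ => 0)) F θ hP g₀ os).l₀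
      (crOfRecord₁₃VAt K₀ (fun _ => 0) (fun _ _ _ _ _ => (fun _ _ _ => 0, fun _ _ _ => 0)) F θ hP g₀ os).vol
      (crOfRecord₁₃VAt K₀ (fun _ => 0) (fun _ _ _ _ _ => (fun _ _ _ => 0, fun _ _ _ => 0)) F θ hP g₀ os).T
      (crOfRecord₁₃VAt K₀ (fun _ => 0) (fun _ _ _ _ _ => (fun _ _ _ => 0, fun _ _ _ => 0)) F θ hP g₀ os).Bad
      (fun K t τ => (crOfRecord₁₃VAt K₀ (fun _ => 0) (fun _ _ _ _ _ => (fun _ _ _ => 0, fun _ _ _ => 0)) F θ hP g₀ os).A K t τ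
        - (crOfRecord₁₃VAt K₀ (fun _ => 0) (fun _ _ _ _ _ => (fun _ _ _ => 0, fun _ _ _ => 0)) F θ hP g₀ os).shA K t τ)
      (fun K t τ => (crOfRecord₁₃VAt K₀ (fun _ => 0) (fun _ _ _ _ _ => (fun _ _ _ => 0, fun _ _ _ => 0)) F θ hP g₀ os).B K t τ
        - (crOfRecord₁₃VAt K₀ (fun _ => 0) (fun _ _ _ _ _ => (fun _ _ _ => 0, fun _ _ _ => 0)) F θ hP g₀ os).shB K t τ)
      (crOfRecord₁₃VAt K₀ (fun _ => 0) (fun _ _ _ _ _ => (fun _ _ _ => 0, fun _ _ _ => 0)) F θ hP g₀ os).δ) ∧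
    Summable (crOfRecord₁₃VAt K₀ (fun _ => 0) (fun _ _ _ _ _ => (fun _ _ _ => 0, fun _ _ _ => 0)) F θ hP g₀ os).δ :=
  core_crOfRecord₁₃VAt_zeroDial_of_core K₀ θ hP g₀ os ((core_cutZero_iff_sandwich K₀ θ g₀ 1 (F.side ^ 4) _ _ δ).2 h) hδ

/-- **… HENCE NODE U5's WHOLE `HybridNE7` DATUM AT THE ZERO-DIAL V READING FROM THE NE7-PROPER WITNESS ALONE** (`NE7.hybridNE7_of_core` with §1's free faces and `W + Wsh <
1`): at this dial NE7b, NE7c and U4′'s weight bookkeeping contribute nothing — the datum IS the displayed core witness + `Σ δ < ∞`. [bookkeeping] -/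
theorem hybridNE7_crOfRecord₁₃VAt_zeroDial_of_core {δ : ℕ → ℝ}
    (h : letI : DecidableEq (Σ K, SiteSeqKey F (K₀ + K)) := Classical.decEq _
      NE7.Core 1 (F.side ^ 4) (classSet₁₃ θ K₀ g₀) (badClass₁₃ θ K₀ g₀ (fun _ => 0)) (weightA₁₃ θ hP K₀ g₀ os) (weightB₁₃ θ hP K₀ g₀ os) δ)
    (hδ : Summable δ) :
    letI := (crOfRecord₁₃VAt K₀ (fun _ => 0) (fun _ _ _ _ _ => (fun _ _ _ => 0, fun _ _ _ => 0)) F θ hP g₀ os).dec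
    HybridNE7 (crOfRecord₁₃VAt K₀ (fun _ => 0) (fun _ _ _ _ _ => (fun _ _ _ => 0, fun _ _ _ => 0)) F θ hP g₀ os).l₀
      (crOfRecord₁₃VAt K₀ (fun _ => 0) (fun _ _ _ _ _ => (fun _ _ _ => 0, fun _ _ _ => 0)) F θ hP g₀ os).vol
      (crOfRecord₁₃VAt K₀ (fun _ => 0) (fun _ _ _ _ _ => (fun _ _ _ => 0, fun _ _ _ => 0)) F θ hP g₀ os).T
      (crOfRecord₁₃VAt K₀ (fun _ => 0) (fun _ _ _ _ _ => (fun _ _ _ => 0, fun _ _ _ => 0)) F θ hP g₀ os).A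
      (crOfRecord₁₃VAt K₀ (fun _ => 0) (fun _ _ _ _ _ => (fun _ _ _ => 0, fun _ _ _ => 0)) F θ hP g₀ os).B
      (crOfRecord₁₃VAt K₀ (fun _ => 0) (fun _ _ _ _ _ => (fun _ _ _ => 0, fun _ _ _ => 0)) F θ hP g₀ os).Bad
      (crOfRecord₁₃VAt K₀ (fun _ => 0) (fun _ _ _ _ _ => (fun _ _ _ => 0, fun _ _ _ => 0)) F θ hP g₀ os).W
      (crOfRecord₁₃VAt K₀ (fun _ => 0) (fun _ _ _ _ _ => (fun _ _ _ => 0, fun _ _ _ => 0)) F θ hP g₀ os).shA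
      (crOfRecord₁₃VAt K₀ (fun _ => 0) (fun _ _ _ _ _ => (fun _ _ _ => 0, fun _ _ _ => 0)) F θ hP g₀ os).shB
      (crOfRecord₁₃VAt K₀ (fun _ => 0) (fun _ _ _ _ _ => (fun _ _ _ => 0, fun _ _ _ => 0)) F θ hP g₀ os).Wsh
      (crOfRecord₁₃VAt K₀ (fun _ => 0) (fun _ _ _ _ _ => (fun _ _ _ => 0, fun _ _ _ => 0)) F θ hP g₀ os).δ := by
  letI := (crOfRecord₁₃VAt K₀ (fun _ => 0) (fun _ _ _ _ _ => (fun _ _ _ => 0, fun _ _ _ => 0)) F θ hP g₀ os).dec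
  obtain ⟨hcore, hsum⟩ := core_crOfRecord₁₃VAt_zeroDial_of_core K₀ θ hP g₀ os h hδ
  exact NE7.hybridNE7_of_core (relWeightBound_crOfRecord₁₃VAt_cutZero K₀ θ hP g₀ os _) (shellWeightBound_crOfRecord₁₃VAt_shellZero K₀ θ hP g₀ os _)
    (lt_one_crOfRecord₁₃VAt_zeroDial K₀ θ hP g₀ os) hsum hcore

end Core

end Summit.QuantumFields.YangMills.BalabanUVNodes.N20ZeroDialFacesAtRecord13CoPHV

end
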